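import Mathlib
import Literature.NumberTheory.Automorphic.CongruenceSubgroupPropertySL2Signs

/-!
# Crux `HilbertIntegralOverconvergentIsCongruence` (stmt-Langlands-8485), line `Sketch-ideate-r1-k1`,
# section K (Götzky–Koecher): stub `stub_exists_unit_lt_one_at` (K-E)

Section K of the line proves the Götzky–Koecher principle (Freitag, *Hilbert Modular Forms*, I.4.9).
Its growth argument needs, for a chosen real embedding `φ` of the number field `K` and a finite-index
subgroup `U` of the unit group `(𝓞 K)ˣ` (e.g. the units congruent to `1` modulo a level), a unit
`ε ∈ U` which is positive at every real embedding, contracting at `φ` (`φ ε < 1`) and expanding at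
every other real embedding (`1 < ψ ε` for real `ψ ≠ φ`).  This file proves the registered stub
`stub_exists_unit_lt_one_at` supplying that unit (under the hypothesis that a second real embedding
exists).

Proof.  Let `w_φ` be the infinite place of `φ`.  Mathlib's proof of Dirichlet's unit theorem
provides a unit `u` with `log |u|_w < 0` for every place `w ≠ w_φ`
(`NumberField.Units.dirichletUnitTheorem.exists_unit`); since distinct real embeddings define
distinct places and `|x|_{w_ψ} = |ψ x|` (tree lemmas
`SerreSL2.mk_comp_algebraMap_injective`, `SerreSL2.mk_comp_algebraMap_apply`), this gives
`|ψ u| < 1` for every real `ψ ≠ φ`, and the product formula `∑_w mult(w) log |u|_w = 0`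
(`NumberField.Units.sum_mult_mul_log`) together with the existence of a second real place forces
`1 < |φ u|`.  The unit `ε := (u⁻¹ ^ 2) ^ [units : U]` lies in `U` (`Subgroup.pow_index_mem`), and
`ψ ε = ((ψ u)²)⁻¹ ^ [units : U]` with `[units : U] ≠ 0`, whence all the sign and size claims.
-/

set_option linter.dupNamespace false -- mandated namespace `Summit.Langlands.Langlands.…` repeats a component

namespace Summit.Langlands.Langlands.Theorems.HilbertIntegralOverconvergentIsCongruence

open NumberField InfinitePlace Literature.NumberTheory.Automorphic

/-- A real embedding evaluated at the unit `(v⁻¹ ^ 2) ^ n` of `𝓞 K`: it is `((ψ v)²)⁻¹ ^ n`. -/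
theorem kE_apply_inv_sq_pow {K : Type} [Field K] (ψ : K →+* ℝ) (v : (𝓞 K)ˣ) (n : ℕ) :
    ψ ((((v⁻¹ ^ 2) ^ n : (𝓞 K)ˣ) : 𝓞 K) : K) = ((ψ ((v : 𝓞 K) : K)) ^ 2)⁻¹ ^ n := by
  have h : ∀ x : 𝓞 K, ψ (x : K) = (ψ.comp (algebraMap (𝓞 K) K)) x := fun _ ↦ rfl
  rw [h, h, Units.val_pow_eq_pow_val, Units.val_pow_eq_pow_val, map_pow, map_pow, map_units_inv,
    inv_pow]

/-- For a real embedding `φ` of a number field with a second real embedding, the unit `u` attached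
to the place of `φ` by Mathlib's proof of Dirichlet's unit theorem satisfies `1 < |φ u|` and
`|ψ u| < 1` for every other real embedding `ψ`. -/
theorem kE_exists_unit_one_lt_abs {K : Type} [Field K] [NumberField K] (φ : K →+* ℝ)
    (hψ : ∃ ψ : K →+* ℝ, ψ ≠ φ) :
    ∃ u : (𝓞 K)ˣ, 1 < |φ ((u : 𝓞 K) : K)| ∧
      ∀ ψ : K →+* ℝ, ψ ≠ φ → |ψ ((u : 𝓞 K) : K)| < 1 := by
  classical
  obtain ⟨u, hu⟩ :=
    NumberField.Units.dirichletUnitTheorem.exists_unit K (InfinitePlace.mk ((algebraMap ℝ ℂ).comp φ))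
  have hupos : ∀ w : InfinitePlace K, 0 < w (((u : 𝓞 K) : K)) := fun w ↦
    NumberField.Units.pos_at_place u w
  refine ⟨u, ?_, fun ψ hne ↦ ?_⟩
  · -- `1 < |φ u|` from `∑_w mult(w) log |u|_w = 0`
    obtain ⟨ψ₀, hψ₀⟩ := hψ
    have hsum := NumberField.Units.sum_mult_mul_log u
    set wφ := InfinitePlace.mk ((algebraMap ℝ ℂ).comp φ) with hwφ
    rw [← Finset.add_sum_erase _ _ (Finset.mem_univ wφ)] at hsum
    have hneg : ∑ w ∈ Finset.univ.erase wφ, (w.mult : ℝ) * Real.log (w (((u : 𝓞 K) : K))) < 0 := by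
      apply Finset.sum_neg
      · intro w hw
        exact mul_neg_of_pos_of_neg (Nat.cast_pos.2 InfinitePlace.mult_pos)
          (hu w (Finset.ne_of_mem_erase hw))
      · exact ⟨InfinitePlace.mk ((algebraMap ℝ ℂ).comp ψ₀), Finset.mem_erase.2
          ⟨fun h ↦ hψ₀ (SerreSL2.mk_comp_algebraMap_injective h), Finset.mem_univ _⟩⟩
    have hpos : 0 < (wφ.mult : ℝ) * Real.log (wφ (((u : 𝓞 K) : K))) := by linarith
    have hlog : 0 < Real.log (wφ (((u : 𝓞 K) : K))) :=
      pos_of_mul_pos_right hpos (Nat.cast_nonneg _)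
    rw [Real.log_pos_iff (hupos _).le, hwφ, SerreSL2.mk_comp_algebraMap_apply] at hlog
    exact hlog
  · -- `|ψ u| < 1` for `ψ ≠ φ`
    have h := hu (InfinitePlace.mk ((algebraMap ℝ ℂ).comp ψ))
      (fun heq ↦ hne (SerreSL2.mk_comp_algebraMap_injective heq))
    rw [Real.log_neg_iff (hupos _)] at h
    rwa [SerreSL2.mk_comp_algebraMap_apply] at h

/-- **stub K-E — `stub_exists_unit_lt_one_at`.** In a finite-index subgroup `U` of the units of a
number field with at least two real embeddings there is, for each real embedding `φ`, a unit `ε ∈ U`,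
positive at all real embeddings, with `φ(ε) < 1 < ψ(ε)` for every real `ψ ≠ φ` (an even power of the
inverse of the unit attached to the place of `φ` by Mathlib's proof of Dirichlet's unit theorem,
`NumberField.Units.dirichletUnitTheorem.exists_unit`, raised to the index of `U`). [folklore] -/
theorem stub_exists_unit_lt_one_at {K : Type} [Field K] [NumberField K] (U : Subgroup (𝓞 K)ˣ)
    (hU : U.FiniteIndex) (φ : K →+* ℝ) (hψ : ∃ ψ : K →+* ℝ, ψ ≠ φ) :
    ∃ ε ∈ U, (∀ ψ : K →+* ℝ, 0 < ψ ((ε : 𝓞 K) : K)) ∧ φ ((ε : 𝓞 K) : K) < 1 ∧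
      ∀ ψ : K →+* ℝ, ψ ≠ φ → 1 < ψ ((ε : 𝓞 K) : K) := by
  obtain ⟨u, hφu, hψu⟩ := kE_exists_unit_one_lt_abs φ hψ
  have hn : U.index ≠ 0 := hU.index_ne_zero
  -- `ψ u ≠ 0` for every real embedding `ψ` (`u` is a unit, `ψ` is injective)
  have hne0 : ∀ ψ : K →+* ℝ, ψ ((u : 𝓞 K) : K) ≠ 0 := fun ψ ↦
    (map_ne_zero ψ).2 (NumberField.Units.coe_ne_zero u)
  refine ⟨(u⁻¹ ^ 2) ^ U.index, Subgroup.pow_index_mem U _, fun ψ ↦ ?_, ?_, fun ψ hne ↦ ?_⟩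
  · -- positivity at every real embedding
    rw [kE_apply_inv_sq_pow]
    exact pow_pos (inv_pos.2 (sq_pos_of_ne_zero (hne0 ψ))) _
  · -- contraction at `φ`
    rw [kE_apply_inv_sq_pow]
    have hsq : 1 < (φ ((u : 𝓞 K) : K)) ^ 2 := by
      rw [← sq_abs]
      exact one_lt_pow₀ hφu two_ne_zero
    exact pow_lt_one₀ (inv_pos.2 (zero_lt_one.trans hsq)).le (inv_lt_one_of_one_lt₀ hsq) hn
  · -- expansion at every real `ψ ≠ φ`
    rw [kE_apply_inv_sq_pow]
    have hsq : (ψ ((u : 𝓞 K) : K)) ^ 2 < 1 := by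
      rw [← sq_abs]
      exact pow_lt_one₀ (abs_nonneg _) (hψu ψ hne) two_ne_zero
    exact one_lt_pow₀ ((one_lt_inv₀ (sq_pos_of_ne_zero (hne0 ψ))).2 hsq) hn

end Summit.Langlands.Langlands.Theorems.HilbertIntegralOverconvergentIsCongruence
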